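/-
Copyright: the b2b-balaban T⁴-continuum CRUX team, row NE7b leaf lineage `t4-ne7b-formalise-leaf-01` (gen 86). Project licence.
-/
import Summits.QuantumFields.BalabanUV.T4Continuum.Spine.NE7b.BlockSectionAgmonLetter
import Summits.QuantumFields.BalabanUV.T4Continuum.Spine.NE7b.HypercubeBlockGap
import Mathlib.Analysis.SpecificLimits.Basic

/-!
# THE ROW-SUM CERTIFICATE SOCKET OF THE SIDE-2 ONE-SHOT SECTION, BY VALUE: for every `t > 1` with `m := 2 − d·(t − 1)²∕(2t) > 0` and EVERY
# finitely supported competitor `φ` with the section's block sums,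
# `Σ'_y |H(p,y)| ≤ Σ_{y}|φ(p − 2y)| + ((t² + 1)∕(t² − 1))^{d∕2}·√(Σ_{q∈T} t^{2|blk q|₁}·(P(−Δ)φ q)²)∕m`;  at `d = 4`, `t = 3∕2`: `m = 5∕3`, `((t²+1)∕(t²−1))² = 169∕25`
# (row NE7b, node U5c; PRICING-NE7b v124 §3 NL-NE7b-1′ limb 1b — T-111's (A-cert) ∕ NC-NE7b-GAMMA-1-A as ONE inequality with a FINITE rational right side;
# [folklore] over this lineage's `BlockSectionAgmonLetter` + `HypercubeBlockGap` BY NAME)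

Cell `pub-balaban`, sub-cell `t4`, spine estimate NE7b (`T4WeightBudget.RelWeightBound`; the cell's OWN estimate — NOT PRINTED in
[Bałaban 1983–89], NOT PROVED).  Crux-route work under `Spine/NE7b/` by a row leaf (`t4-ne7b-formalise-leaf-01` gen 86) under FREEZE (0)'s
crux-prover clause; NOTHING of Bałaban's is named as a Lean object, valued or asserted; no `T4Continuum/Support` leaf typed; no `def` (the `ℓ¹` block
norm is written `Σ_μ |y_μ|` = `∑ μ, (y μ).natAbs`, the weight `t^{min(|y|₁, T)}` inline); zero `sorry`.  Imports: this lineage's `BlockSectionAgmonLetter`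
(`tsum_abs_kerH_le_of_family`: the weight-family socket) and `HypercubeBlockGap` (`blockGap_two`: the side-2 gap `2`), Mathlib's `SpecificLimits.Basic` (geometric series).

WHY.  PRICING-NE7b v124 §3 ∕ F745: limb 1b's cheapest certificate at `M = 2`, `d = 4` is ONE number, `ρ_∞ = Σ_{y∈ℤ⁴}|H(p,y)| ≤ 2.70 (< 1 + √3)`, and at
kernel weight it needs (e1) an explicit decay letter + (e2) near-field values + (e3) an images identity.  The two sibling files give (e1) a-posteriori and
the row-sum socket for an ABSTRACT block weight; THIS FILE fixes the weight family `w_T(y) = t^{min(Σ_μ|y_μ|, T)}` (block-`ℓ¹`, truncated so that it is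
bounded; bond ratios `≤ t + t⁻¹`, i.e. `η = (t−1)²∕(2t)`), takes the side-2 gap `2` from `HypercubeBlockGap`, sums the inverse-square weights over `ℤ^d`
(`Σ_y t^{−2|c − y|₁} ≤ ((t²+1)∕(t²−1))^d`, a product of two-sided geometric series), chooses `T` per window, and delivers the CLOSED socket: the only
inputs left are the competitor `φ` (finitely supported, block sums `2^d·δ_{y0}`), its support `S` and a residual window `T`; the right side is a finite
sum — rational when `φ` and `t` are.  Float preview (this seat, `g86/numerics/cert_eval2.py`, torus `R = 12` proxy for the section): `t = 3∕2`, `φ :=`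
the section truncated to `|blk|_∞ ≤ 4` (9⁴ blocks): `ρ_∞ ≤ 2.5449 + 0.049 = 2.594 < 2.732` — the certificate itself (exact rationals on a symmetrised
dyadic `φ`, 495 orbit values) is a balaban-calc ∕ `--computational` deliverable, NOT this file.

WHAT IS PROVED (side 2, i.e. `n = 1`; every `d`; every `a > 0`; all [folklore]):
* §1 `natAbs_l1_add_e_le` ∕ `natAbs_l1_le_add_e` (the block `ℓ¹` norm is 1-Lipschitz across bonds), `pow_min_ratio_le` (`t^a∕t^b + t^b∕t^a ≤ t + t⁻¹`
  for naturals `a, b` at distance `≤ 1`), the weight lemmas `weight_pos` ∕ `weight_le` ∕ `weight_ratio_le`.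
* §2 `sum_pow_natAbs_le` (`Σ_{j∈J} s^{|c − j|} ≤ (1+s)∕(1−s)`, `0 < s < 1`), **`sum_inv_sq_weight_le`** (`Σ_{y∈Y} t^{−2|c − y|₁} ≤ ((t²+1)∕(t²−1))^d`).
* §3 **`rowSum_certificate`**: `1 < t`, `0 < m := 2 − d·((t + t⁻¹)∕2 − 1)`, `φ` supported in `S` with `Σ_{B(y)}φ = 2^d·δ_{y0}`, `P(−Δ)φ = 0` off `T` ⟹
  `y ↦ |kerH 1 a p y|` is summable and
  **`Σ'_y |kerH 1 a p y| ≤ Σ_{y∈Y_p}|φ(p − 2y)| + √(((t²+1)∕(t²−1))^d)·√(Σ_{q∈T}(t^{Σ_μ|(blk q)_μ|}·P(−Δ)φ q)²)∕m`**, `Y_p = (S.image blk).image (blk p − ·)`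
  (the finitely many `y` with `φ(p − 2y) ≠ 0`); **`rowSum_certificate_four`** (`d = 4`, `t = 3∕2`: `m = 5∕3`, `√(…^4) = 169∕25`).

HONEST: [folklore]; the number `2.594` is a float preview, NOT certified here; the certificate `φ` is not in this file; `ℤ^d` object (every torus by
T-111 L4 — not here); scalar `U = 1` skeleton — nothing of (A3) ∕ NC-NE7b-α; BY-NAME EFFECT ON THE WALL: NONE.  NE7b NOT PRINTED ∕ NOT PROVED; spine
PROVED 0∕9; rung (B)+1 on a FINITE torus — NOT infinite volume, NOT the mass gap, NOT Clay.  HONEST DEPENDENCY: continuum YM on T⁴ ⇐ BetaPertH ∧ nine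
spine estimates (0∕9 proved); BetaPertH ⇐ (D1) ∧ (D4) ∧ CAP+tail; G-an2-4 gates asym, D1 and NE2∕3∕4.
-/

set_option autoImplicit false

namespace Summit.QuantumFields.BalabanUV.T4Continuum.NE7b.BlockSectionRowSumCertificate

open Finset
open Literature.MathematicalPhysics.QuantumFieldTheory.Balaban1983to89
open B6QGQLower276 (X B e blk loc e_apply_self e_apply_ne)
open B5Hk103ScalarZd (kerH)
open B5Hk103Unique (lapRow)
open B5Hk165TranslZd (bshift)
open Summit.QuantumFields.BalabanUV.T4Continuum.NE7b.BlockSectionAgmonEngine (blk_sub_bshift)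
open Summit.QuantumFields.BalabanUV.T4Continuum.NE7b.BlockSectionAgmonLetter (tsum_abs_kerH_le_of_family)
open Summit.QuantumFields.BalabanUV.T4Continuum.NE7b.HypercubeBlockGap (blockGap_two)

noncomputable section

variable {d : ℕ}

/-! ## §1  The block `ℓ¹` norm and the weight family `t^{min(|y|₁, T)}` [folklore] -/

/-- `|y + e_ν|₁ ≤ |y|₁ + 1`. [folklore] -/
theorem natAbs_l1_add_e_le (y : X d) (ν : Fin d) : ∑ μ, ((y + e ν) μ).natAbs ≤ ∑ μ, (y μ).natAbs + 1 := by
  classical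
  have h : ∀ μ, ((y + e ν) μ).natAbs ≤ (y μ).natAbs + (if μ = ν then 1 else 0) := by
    intro μ
    by_cases hμ : μ = ν
    · subst hμ; rw [if_pos rfl, Pi.add_apply, e_apply_self]; omega
    · rw [if_neg hμ, Pi.add_apply, e_apply_ne hμ, add_zero, add_zero]
  calc ∑ μ, ((y + e ν) μ).natAbs ≤ ∑ μ, ((y μ).natAbs + (if μ = ν then 1 else 0)) := Finset.sum_le_sum fun μ _ => h μ
    _ = ∑ μ, (y μ).natAbs + 1 := by rw [Finset.sum_add_distrib, Finset.sum_ite_eq' Finset.univ ν, if_pos (Finset.mem_univ _)]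

/-- `|y|₁ ≤ |y + e_ν|₁ + 1`. [folklore] -/
theorem natAbs_l1_le_add_e (y : X d) (ν : Fin d) : ∑ μ, (y μ).natAbs ≤ ∑ μ, ((y + e ν) μ).natAbs + 1 := by
  classical
  have h : ∀ μ, (y μ).natAbs ≤ ((y + e ν) μ).natAbs + (if μ = ν then 1 else 0) := by
    intro μ
    by_cases hμ : μ = ν
    · subst hμ; rw [if_pos rfl, Pi.add_apply, e_apply_self]; omega
    · rw [if_neg hμ, Pi.add_apply, e_apply_ne hμ, add_zero, add_zero]
  calc ∑ μ, (y μ).natAbs ≤ ∑ μ, (((y + e ν) μ).natAbs + (if μ = ν then 1 else 0)) := Finset.sum_le_sum fun μ _ => h μ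
    _ = ∑ μ, ((y + e ν) μ).natAbs + 1 := by rw [Finset.sum_add_distrib, Finset.sum_ite_eq' Finset.univ ν, if_pos (Finset.mem_univ _)]

/-- For `t > 0` and naturals `a, b` at distance `≤ 1`: `t^a∕t^b + t^b∕t^a ≤ t + t⁻¹`. [folklore] -/
theorem pow_min_ratio_le {t : ℝ} (ht : 0 < t) {a b : ℕ} (h1 : a ≤ b + 1) (h2 : b ≤ a + 1) :
    t ^ a / t ^ b + t ^ b / t ^ a ≤ t + t⁻¹ := by
  have hta : 0 < t ^ a := pow_pos ht a
  have htb : 0 < t ^ b := pow_pos ht b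
  have hAMGM : (2 : ℝ) ≤ t + t⁻¹ := by
    have h : t + t⁻¹ - 2 = (t - 1) ^ 2 / t := by
      field_simp
      ring
    have : 0 ≤ (t - 1) ^ 2 / t := by positivity
    linarith
  rcases Nat.lt_or_ge a b with hab | hab
  · have hb : b = a + 1 := by omega
    subst hb
    rw [pow_succ]
    have : t ^ a / (t ^ a * t) + t ^ a * t / t ^ a = t⁻¹ + t := by field_simp
    rw [this, add_comm]
  · rcases Nat.lt_or_ge b a with hba | hba
    · have ha : a = b + 1 := by omega
      subst ha
      rw [pow_succ]
      have : t ^ b * t / t ^ b + t ^ b / (t ^ b * t) = t + t⁻¹ := by field_simp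
      rw [this]
    · have hab' : a = b := le_antisymm hba hab
      subst hab'
      rw [div_self hta.ne']
      linarith

/-- The weight `t^{min(|y|₁, T)}` is positive. [folklore] -/
theorem weight_pos {t : ℝ} (ht : 0 < t) (Tc : ℕ) (y : X d) : 0 < t ^ min (∑ μ, (y μ).natAbs) Tc := pow_pos ht _

/-- The weight is bounded: `t^{min(|y|₁, T)} ≤ t^T` (`t ≥ 1`). [folklore] -/
theorem weight_le {t : ℝ} (ht : 1 ≤ t) (Tc : ℕ) (y : X d) : t ^ min (∑ μ, (y μ).natAbs) Tc ≤ t ^ Tc :=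
  pow_le_pow_right₀ ht (min_le_right _ _)

/-- The weight's bond ratios: `w(y)∕w(y + e_ν) + w(y + e_ν)∕w(y) ≤ t + t⁻¹ = 2 + 2·((t + t⁻¹)∕2 − 1)`. [folklore] -/
theorem weight_ratio_le {t : ℝ} (ht : 0 < t) (Tc : ℕ) (y : X d) (ν : Fin d) :
    t ^ min (∑ μ, (y μ).natAbs) Tc / t ^ min (∑ μ, ((y + e ν) μ).natAbs) Tc +
      t ^ min (∑ μ, ((y + e ν) μ).natAbs) Tc / t ^ min (∑ μ, (y μ).natAbs) Tc ≤ 2 + 2 * ((t + t⁻¹) / 2 - 1) := by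
  have h := pow_min_ratio_le ht (a := min (∑ μ, (y μ).natAbs) Tc) (b := min (∑ μ, ((y + e ν) μ).natAbs) Tc)
    (by have := natAbs_l1_le_add_e y ν; omega) (by have := natAbs_l1_add_e_le y ν; omega)
  linarith

/-! ## §2  Geometric sums: `Σ_y t^{−2|c − y|₁} ≤ ((t²+1)∕(t²−1))^d` [folklore] -/

/-- One dimension: `Σ_{j∈J} s^{|c − j|} ≤ (1 + s)∕(1 − s)` for finite `J ⊂ ℤ`, `0 ≤ s < 1` (two geometric series). [folklore] -/
theorem sum_pow_natAbs_le {s : ℝ} (hs0 : 0 ≤ s) (hs1 : s < 1) (c : ℤ) (J : Finset ℤ) :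
    ∑ j ∈ J, s ^ (c - j).natAbs ≤ (1 + s) / (1 - s) := by
  classical
  -- the two-sided geometric series on `ℤ`: `Σ'_{i∈ℤ} s^{|i|} = (1−s)⁻¹ + s(1−s)⁻¹ = (1+s)∕(1−s)`
  have hf : HasSum (fun n : ℕ => s ^ n) (1 - s)⁻¹ := hasSum_geometric_of_lt_one hs0 hs1
  have hg : HasSum (fun n : ℕ => s ^ (n + 1)) (s * (1 - s)⁻¹) := by
    have h := hf.mul_left s
    refine h.congr_fun fun n => ?_
    ring
  have hZ : HasSum (fun i : ℤ => s ^ i.natAbs) ((1 - s)⁻¹ + s * (1 - s)⁻¹) := by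
    refine HasSum.of_nat_of_neg_add_one ?_ ?_
    · refine hf.congr_fun fun n => ?_
      simp only [Int.natAbs_natCast]
    · refine hg.congr_fun fun n => ?_
      have : (-((n : ℤ) + 1)).natAbs = n + 1 := by omega
      rw [this]
  have hval : (1 - s)⁻¹ + s * (1 - s)⁻¹ = (1 + s) / (1 - s) := by
    have : (1 - s) ≠ 0 := by linarith
    field_simp
  -- reindex `j ↦ c − j` and compare the finite sum with the series
  have hinj : Set.InjOn (fun j : ℤ => c - j) ↑J := fun j₁ _ j₂ _ h => by simpa using h
  calc ∑ j ∈ J, s ^ (c - j).natAbs = ∑ i ∈ J.image (fun j => c - j), s ^ i.natAbs := by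
        rw [Finset.sum_image hinj]
    _ ≤ (1 - s)⁻¹ + s * (1 - s)⁻¹ := sum_le_hasSum _ (fun i _ => pow_nonneg hs0 _) hZ
    _ = (1 + s) / (1 - s) := hval

/-- **THE INVERSE-SQUARE WEIGHT SUM**: for `t > 1`, every centre `c` and every finite `Y ⊂ ℤ^d`,
`Σ_{y∈Y} t^{−2·|c − y|₁} ≤ ((t² + 1)∕(t² − 1))^d` — a product of `d` two-sided geometric series with ratio `t⁻²`. [folklore] -/
theorem sum_inv_sq_weight_le {t : ℝ} (ht : 1 < t) (c : X d) (Y : Finset (X d)) :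
    ∑ y ∈ Y, ((t ^ (∑ μ, ((c - y) μ).natAbs))⁻¹) ^ 2 ≤ ((t ^ 2 + 1) / (t ^ 2 - 1)) ^ d := by
  classical
  have ht0 : 0 < t := by linarith
  set s : ℝ := (t ^ 2)⁻¹ with hs
  have hs0 : 0 ≤ s := by positivity
  have hs1 : s < 1 := by
    rw [hs]; exact inv_lt_one_of_one_lt₀ (by nlinarith)
  have hval : (t ^ 2 + 1) / (t ^ 2 - 1) = (1 + s) / (1 - s) := by
    have h1 : t ^ 2 ≠ 0 := by positivity
    have h2 : t ^ 2 - 1 ≠ 0 := by nlinarith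
    rw [hs]; field_simp
  -- each term is the product over coordinates of `s^{|c_μ − y_μ|}`
  have hterm : ∀ y : X d, ((t ^ (∑ μ, ((c - y) μ).natAbs))⁻¹) ^ 2 = ∏ μ, s ^ ((c μ - y μ)).natAbs := by
    intro y
    have h1 : ((t ^ (∑ μ, ((c - y) μ).natAbs))⁻¹) ^ 2 = s ^ (∑ μ, ((c - y) μ).natAbs) := by
      rw [hs]
      simp only [inv_pow, ← pow_mul]
      rw [Nat.mul_comm]
    rw [h1, ← Finset.prod_pow_eq_pow_sum]
    rfl
  rw [Finset.sum_congr rfl fun y _ => hterm y]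
  -- enlarge `Y` to the box `Π_μ (Y.image (· μ))` and factorise
  set box : Finset (X d) := Fintype.piFinset fun μ => Y.image fun y : X d => y μ with hbox
  have hsub : Y ⊆ box := fun y hy => Fintype.mem_piFinset.2 fun μ => Finset.mem_image_of_mem _ hy
  calc ∑ y ∈ Y, ∏ μ, s ^ (c μ - y μ).natAbs ≤ ∑ y ∈ box, ∏ μ, s ^ (c μ - y μ).natAbs :=
        Finset.sum_le_sum_of_subset_of_nonneg hsub fun y _ _ => Finset.prod_nonneg fun μ _ => pow_nonneg hs0 _
    _ = ∏ μ : Fin d, ∑ j ∈ Y.image (fun y : X d => y μ), s ^ (c μ - j).natAbs := by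
        rw [hbox, Finset.prod_univ_sum]
    _ ≤ ∏ _μ : Fin d, (1 + s) / (1 - s) :=
        Finset.prod_le_prod (fun μ _ => Finset.sum_nonneg fun j _ => pow_nonneg hs0 _)
          fun μ _ => sum_pow_natAbs_le hs0 hs1 (c μ) _
    _ = ((t ^ 2 + 1) / (t ^ 2 - 1)) ^ d := by rw [Finset.prod_const, Finset.card_univ, Fintype.card_fin, hval]

/-! ## §3  The closed socket at side 2 [folklore] -/

/-- **THE ROW-SUM CERTIFICATE SOCKET (side 2, every `d`)**: `1 < t`, `0 < m := 2 − d·((t + t⁻¹)∕2 − 1)`; a competitor `φ` supported in `S` with the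
section's block sums `Σ_{B(y)}φ = 2^d·δ_{y0}` and residual `P(−Δ)φ` vanishing off `T` ⟹ `y ↦ |H(p,y)|` is summable and
`Σ'_y |kerH 1 a p y| ≤ Σ_{y∈Y_p}|φ(p − 2y)| + √(((t²+1)∕(t²−1))^d)·√(Σ_{q∈T}(t^{|blk q|₁}·P(−Δ)φ q)²)∕m`, `Y_p = (S.image blk).image (blk p − ·)`.
The right side is a finite expression in the data; rational when `φ`, `t` are. [folklore] -/
theorem rowSum_certificate {t : ℝ} (ht : 1 < t) (hm : 0 < 2 - d * ((t + t⁻¹) / 2 - 1)) {a : ℝ} (ha : 0 < a)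
    (φ : X d → ℝ) (S : Finset (X d)) (hS : ∀ q ∉ S, φ q = 0)
    (hφ : ∀ y : X d, ∑ q ∈ B 1 y, φ q = (2 : ℝ) ^ d * (if y = 0 then 1 else 0))
    (T : Finset (X d)) (hT : ∀ q ∉ T, lapRow φ q - ((2 : ℝ) ^ d)⁻¹ * ∑ r ∈ B 1 (blk 1 q), lapRow φ r = 0) (p : X d) :
    Summable (fun y => |kerH 1 a p y|) ∧
      ∑' y, |kerH 1 a p y| ≤ ∑ y ∈ (S.image (blk 1)).image (fun b => blk 1 p - b), |φ (p - bshift 1 y)| +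
        Real.sqrt (((t ^ 2 + 1) / (t ^ 2 - 1)) ^ d) *
          (Real.sqrt (∑ q ∈ T, (t ^ (∑ μ, ((blk 1 q) μ).natAbs) *
              (lapRow φ q - ((2 : ℝ) ^ d)⁻¹ * ∑ r ∈ B 1 (blk 1 q), lapRow φ r)) ^ 2) /
            (2 - d * ((t + t⁻¹) / 2 - 1))) := by
  classical
  have ht0 : 0 < t := by linarith
  -- the letter's statements carry `((1 : ℕ) + 1 : ℝ)`; normalise to `2`
  have hφ' : ∀ y : X d, ∑ q ∈ B 1 y, φ q = (((1 : ℕ) : ℝ) + 1) ^ d * (if y = 0 then 1 else 0) := fun y => by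
    rw [hφ y]; norm_num
  have hT' : ∀ q ∉ T, lapRow φ q - ((((1 : ℕ) : ℝ) + 1) ^ d)⁻¹ * ∑ r ∈ B 1 (blk 1 q), lapRow φ r = 0 := fun q hq => by
    have h := hT q hq; norm_num at h ⊢; exact h
  have ht1 : 1 ≤ t := ht.le
  have hη : 0 ≤ (t + t⁻¹) / 2 - 1 := by
    have h := pow_min_ratio_le ht0 (a := 0) (b := 0) (by omega) (by omega)
    simp only [pow_zero, div_one] at h
    linarith
  set Yp : Finset (X d) := (S.image (blk 1)).image (fun b => blk 1 p - b) with hYp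
  set Rres : ℝ := Real.sqrt (∑ q ∈ T, (t ^ (∑ μ, ((blk 1 q) μ).natAbs) *
      (lapRow φ q - ((2 : ℝ) ^ d)⁻¹ * ∑ r ∈ B 1 (blk 1 q), lapRow φ r)) ^ 2) with hRres
  -- (A) the competitor's own row sum over any window is at most its row sum over `Yp`
  have hA : ∀ Y : Finset (X d), ∑ y ∈ Y, |φ (p - bshift 1 y)| ≤ ∑ y ∈ Yp, |φ (p - bshift 1 y)| := by
    intro Y
    have hzero : ∀ y ∉ Yp, |φ (p - bshift 1 y)| = 0 := by
      intro y hy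
      rw [abs_eq_zero]
      apply hS
      intro hmem
      apply hy
      rw [hYp, Finset.mem_image]
      exact ⟨blk 1 (p - bshift 1 y), Finset.mem_image_of_mem _ hmem, by rw [blk_sub_bshift]; abel⟩
    calc ∑ y ∈ Y, |φ (p - bshift 1 y)| = ∑ y ∈ Y.filter (fun y => y ∈ Yp), |φ (p - bshift 1 y)| := by
          rw [← Finset.sum_filter_add_sum_filter_not Y (fun y => y ∈ Yp)]
          have h0 : ∑ y ∈ Y.filter (fun y => ¬ y ∈ Yp), |φ (p - bshift 1 y)| = 0 :=
            Finset.sum_eq_zero fun y hy => hzero y (Finset.mem_filter.1 hy).2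
          rw [h0, add_zero]
      _ ≤ ∑ y ∈ Yp, |φ (p - bshift 1 y)| :=
          Finset.sum_le_sum_of_subset_of_nonneg (fun y hy => (Finset.mem_filter.1 hy).2) fun y _ _ => abs_nonneg _
  -- (B) the weight FAMILY: for each window `Y` the truncation `T(Y)` sits above every `|·|₁` in sight, so the weight reads untruncated on `Y` and `T`
  have hfam : ∀ Y : Finset (X d), ∃ (w : X d → ℝ) (W : ℝ), (∀ y, 0 < w y) ∧ (∀ y, w y ≤ W) ∧
      (∀ (y : X d) (μ : Fin d), w y / w (y + e μ) + w (y + e μ) / w y ≤ 2 + 2 * ((t + t⁻¹) / 2 - 1)) ∧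
      (∑ y ∈ Y, ((w (blk 1 p - y))⁻¹) ^ 2 ≤ ((t ^ 2 + 1) / (t ^ 2 - 1)) ^ d) ∧
      (∑ q ∈ T, (w (blk 1 q) * (lapRow φ q - ((((1 : ℕ) : ℝ) + 1) ^ d)⁻¹ * ∑ r ∈ B 1 (blk 1 q), lapRow φ r)) ^ 2
        ≤ Rres ^ 2) := by
    intro Y
    set Tc : ℕ := Y.sup (fun y => ∑ μ, ((blk 1 p - y) μ).natAbs) ⊔ T.sup (fun q => ∑ μ, ((blk 1 q) μ).natAbs) with hTc
    set w : X d → ℝ := fun y => t ^ min (∑ μ, (y μ).natAbs) Tc with hw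
    refine ⟨w, t ^ Tc, fun y => weight_pos ht0 Tc y, fun y => weight_le ht1 Tc y, fun y μ => weight_ratio_le ht0 Tc y μ, ?_, ?_⟩
    · -- on `Y` the weight is untruncated: `w(blk p − y) = t^{|blk p − y|₁}`
      have hY' : ∀ y ∈ Y, w (blk 1 p - y) = t ^ (∑ μ, ((blk 1 p - y) μ).natAbs) := by
        intro y hy
        simp only [hw]
        rw [min_eq_left]
        exact le_trans (Finset.le_sup (f := fun y => ∑ μ, ((blk 1 p - y) μ).natAbs) hy) le_sup_left
      rw [Finset.sum_congr rfl fun y hy => by rw [hY' y hy]]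
      exact sum_inv_sq_weight_le ht (blk 1 p) Y
    · -- on `T` the weight is untruncated as well, so the residual sum is `Rres²`
      have hT'' : ∀ q ∈ T, w (blk 1 q) = t ^ (∑ μ, ((blk 1 q) μ).natAbs) := by
        intro q hq
        simp only [hw]
        rw [min_eq_left]
        exact le_trans (Finset.le_sup (f := fun q => ∑ μ, ((blk 1 q) μ).natAbs) hq) le_sup_right
      rw [Finset.sum_congr rfl fun q hq => by rw [hT'' q hq], hRres,
        Real.sq_sqrt (Finset.sum_nonneg fun q _ => sq_nonneg _)]
      norm_num
  have h := tsum_abs_kerH_le_of_family 1 le_rfl ha φ S hS hφ' T hT' ((t + t⁻¹) / 2 - 1) hη 2 hm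
    (fun y u hu => blockGap_two y u hu) p (Real.sqrt_nonneg _) hA hfam
  simpa only [Nat.cast_one, one_add_one_eq_two] using h

/-- **`d = 4`, `t = 3∕2`** — the row's case by value: `m = 2 − 4·(1∕12) = 5∕3`, `√(((9∕4 + 1)∕(9∕4 − 1))⁴) = (13∕5)² = 169∕25`:
`Σ'_y |kerH 1 a p y| ≤ Σ_{y∈Y_p}|φ(p − 2y)| + (169∕25)·√(Σ_{q∈T}((3∕2)^{|blk q|₁}·P(−Δ)φ q)²)∕(5∕3)`. [folklore] -/
theorem rowSum_certificate_four {a : ℝ} (ha : 0 < a) (φ : X 4 → ℝ) (S : Finset (X 4)) (hS : ∀ q ∉ S, φ q = 0)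
    (hφ : ∀ y : X 4, ∑ q ∈ B 1 y, φ q = (2 : ℝ) ^ 4 * (if y = 0 then 1 else 0))
    (T : Finset (X 4)) (hT : ∀ q ∉ T, lapRow φ q - ((2 : ℝ) ^ 4)⁻¹ * ∑ r ∈ B 1 (blk 1 q), lapRow φ r = 0) (p : X 4) :
    Summable (fun y => |kerH 1 a p y|) ∧
      ∑' y, |kerH 1 a p y| ≤ ∑ y ∈ (S.image (blk 1)).image (fun b => blk 1 p - b), |φ (p - bshift 1 y)| +
        (169 / 25) * (Real.sqrt (∑ q ∈ T, (((3 : ℝ) / 2) ^ (∑ μ, ((blk 1 q) μ).natAbs) *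
            (lapRow φ q - ((2 : ℝ) ^ 4)⁻¹ * ∑ r ∈ B 1 (blk 1 q), lapRow φ r)) ^ 2) / (5 / 3)) := by
  have hm : (0 : ℝ) < 2 - (4 : ℕ) * ((((3 : ℝ) / 2) + ((3 : ℝ) / 2)⁻¹) / 2 - 1) := by norm_num
  have h := rowSum_certificate (d := 4) (t := (3 : ℝ) / 2) (by norm_num) hm ha φ S hS hφ T hT p
  have h1 : (2 : ℝ) - (4 : ℕ) * ((((3 : ℝ) / 2) + ((3 : ℝ) / 2)⁻¹) / 2 - 1) = 5 / 3 := by norm_num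
  have h2 : Real.sqrt (((((3 : ℝ) / 2) ^ 2 + 1) / (((3 : ℝ) / 2) ^ 2 - 1)) ^ 4) = 169 / 25 := by
    rw [show ((((3 : ℝ) / 2) ^ 2 + 1) / (((3 : ℝ) / 2) ^ 2 - 1)) ^ 4 = (169 / 25) ^ 2 by norm_num]
    exact Real.sqrt_sq (by norm_num)
  rw [h1, h2] at h
  exact h

end

end Summit.QuantumFields.BalabanUV.T4Continuum.NE7b.BlockSectionRowSumCertificate
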